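import Summits.MatrixMultiplication.MatrixMultiplication.Theorems.SoloBlindLocality

/-!
# Representation families are 3-sunflower-free (kernel lemma for the face analysis of H♯)

Sub-programme (K₃).  For `h : ι → G` zero-sum free on `S` in a group of exponent `3`, the representations of
any target `τ` (`T ⊆ S`, `Σ_T h = τ`) contain NO SUNFLOWER WITH THREE PETALS: if `T₁, T₂, T₃` pairwise meet in
the same core `K` then `T₁ = T₂ = T₃` — the three petals `T_a \ K` are pairwise disjoint and their union sums to
`3τ - 3 Σ_K h = 0`.  (Three pairwise disjoint representations are the case `K = ∅`, used in the Erdős–Rado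
layer bound `SoloBlindErdosRadoLayer`; the general core is what the face analysis needs.)

COROLLARY (`soloBlind_rep_trace_ne_core`): for two distinct representations `Tᵢ ≠ Tⱼ` no third
representation `T` can have trace `T ∩ (Tᵢ ∪ Tⱼ)` equal to the core `Tᵢ ∩ Tⱼ`.  In the language of the
face analysis of Conjecture H♯ (`SoloBlindLocality`): a "C-killer" of the face of `Tᵢ, Tⱼ` (a representation
whose trace lies inside `C = Tᵢ ∩ Tⱼ`) always has trace a PROPER subset of `C`, which is what makes the
colouring "`(Tᵢ ∪ Tⱼ) \ (C \ T)` red" rescue every face with at most one C-killer.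

THEOREM PC(C≤1) (`soloBlind_face_rescued_of_CKiller_le_one`, set language): let `σ` satisfy the H-goodness
clause `Σ_T h ≠ σ + σ` for all `T ⊆ S`, let `Tᵢ ≠ Tⱼ` represent `σ` with no third representation inside
`U = Tᵢ ∪ Tⱼ` (a FACE of the cube complex of `SoloBlindLocality`), and suppose at most one other representation has
its trace `T ∩ U` inside the core `C = Tᵢ ∩ Tⱼ` ("at most one C-killer").  Then there is a red set `R ⊆ U` such
that the colouring "`R` red, `S \ R` blue" leaves NO representation of `σ` monochromatic and is GOOD
(`R ∈ soloBlindGoodColourings h S σ`): the face pays for its own demand.  (`R = U \ C` with the value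
`V = C` when there is no C-killer; `R = (U \ C) ∪ (T ∩ U)` with the certificate `1_{Tᵢ} + 1_{Tⱼ} - 1_T` when
`T` is the C-killer.)  Together with the pen theorem PC(≤1) (at most one "AB-killer" ⟹ the face pays) this is
the FACE-FAILURE THEOREM of the notes: a face with no rescued colouring — such as the face of the witness `P°` in
`SoloBlindLocality` — has at least two C-killers and at least two AB-killers.
-/

namespace Summit.MatrixMultiplication.MatrixMultiplication.Theorems

open Finset

variable {ι : Type*} [DecidableEq ι] {G : Type*} [AddCommGroup G]

/-- REPRESENTATION FAMILIES ARE 3-SUNFLOWER-FREE: three representations of the same target by a zero-sum-free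
`h` (exponent `3`) that pairwise intersect in the same core coincide. -/
theorem soloBlind_rep_sunflower_free (three : ∀ g : G, g + g + g = 0) {h : ι → G} {S : Finset ι}
    (zsf : ∀ T ⊆ S, T.Nonempty → ∑ i ∈ T, h i ≠ 0) {τ : G} {T₁ T₂ T₃ : Finset ι}
    (hT₁ : T₁ ⊆ S) (hT₂ : T₂ ⊆ S) (hT₃ : T₃ ⊆ S)
    (s₁ : ∑ i ∈ T₁, h i = τ) (s₂ : ∑ i ∈ T₂, h i = τ) (s₃ : ∑ i ∈ T₃, h i = τ)
    (c₁₃ : T₁ ∩ T₃ = T₁ ∩ T₂) (c₂₃ : T₂ ∩ T₃ = T₁ ∩ T₂) : T₁ = T₂ := by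
  set K := T₁ ∩ T₂ with hK
  have hK₁ : K ⊆ T₁ := inter_subset_left
  have hK₂ : K ⊆ T₂ := inter_subset_right
  have hK₃ : K ⊆ T₃ := fun x hx => (mem_inter.mp (c₁₃.symm ▸ hx : x ∈ T₁ ∩ T₃)).2
  -- the petals
  have e₁ : ∑ i ∈ T₁ \ K, h i = τ - ∑ i ∈ K, h i := by
    rw [eq_sub_iff_add_eq, sum_sdiff hK₁, s₁]
  have e₂ : ∑ i ∈ T₂ \ K, h i = τ - ∑ i ∈ K, h i := by
    rw [eq_sub_iff_add_eq, sum_sdiff hK₂, s₂]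
  have e₃ : ∑ i ∈ T₃ \ K, h i = τ - ∑ i ∈ K, h i := by
    rw [eq_sub_iff_add_eq, sum_sdiff hK₃, s₃]
  have d₁₂ : Disjoint (T₁ \ K) (T₂ \ K) := by
    rw [disjoint_left]
    intro x hx₁ hx₂
    exact (mem_sdiff.mp hx₁).2 (mem_inter.mpr ⟨(mem_sdiff.mp hx₁).1, (mem_sdiff.mp hx₂).1⟩)
  have d₁₃ : Disjoint (T₁ \ K) (T₃ \ K) := by
    rw [disjoint_left]
    intro x hx₁ hx₃
    have : x ∈ T₁ ∩ T₃ := mem_inter.mpr ⟨(mem_sdiff.mp hx₁).1, (mem_sdiff.mp hx₃).1⟩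
    exact (mem_sdiff.mp hx₁).2 (c₁₃ ▸ this)
  have d₂₃ : Disjoint (T₂ \ K) (T₃ \ K) := by
    rw [disjoint_left]
    intro x hx₂ hx₃
    have : x ∈ T₂ ∩ T₃ := mem_inter.mpr ⟨(mem_sdiff.mp hx₂).1, (mem_sdiff.mp hx₃).1⟩
    exact (mem_sdiff.mp hx₂).2 (c₂₃ ▸ this)
  -- the union of the petals is a zero sum
  have hzero : ∑ i ∈ (T₁ \ K) ∪ (T₂ \ K) ∪ (T₃ \ K), h i = 0 := by
    rw [sum_union (disjoint_union_left.mpr ⟨d₁₃, d₂₃⟩), sum_union d₁₂, e₁, e₂, e₃]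
    have h3 := three τ
    have h3' := three (∑ i ∈ K, h i)
    calc τ - ∑ i ∈ K, h i + (τ - ∑ i ∈ K, h i) + (τ - ∑ i ∈ K, h i)
        = (τ + τ + τ) - (∑ i ∈ K, h i + ∑ i ∈ K, h i + ∑ i ∈ K, h i) := by abel
      _ = 0 := by rw [h3, h3', sub_zero]
  have hsub : (T₁ \ K) ∪ (T₂ \ K) ∪ (T₃ \ K) ⊆ S :=
    union_subset (union_subset (sdiff_subset.trans hT₁) (sdiff_subset.trans hT₂)) (sdiff_subset.trans hT₃)
  have hempty : (T₁ \ K) ∪ (T₂ \ K) ∪ (T₃ \ K) = ∅ := by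
    by_contra hne
    exact zsf _ hsub (nonempty_iff_ne_empty.mpr hne) hzero
  obtain ⟨h12, h3e⟩ := union_eq_empty.mp hempty
  obtain ⟨h1e, h2e⟩ := union_eq_empty.mp h12
  have t₁ : T₁ ⊆ K := sdiff_eq_empty_iff_subset.mp h1e
  have t₂ : T₂ ⊆ K := sdiff_eq_empty_iff_subset.mp h2e
  exact Subset.antisymm (t₁.trans hK₂) (t₂.trans hK₁)

/-- COROLLARY (no C-killer with full trace): if `Tᵢ ≠ Tⱼ` are representations of `τ`, no representation `T`
has `T ∩ (Tᵢ ∪ Tⱼ) = Tᵢ ∩ Tⱼ`. -/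
theorem soloBlind_rep_trace_ne_core (three : ∀ g : G, g + g + g = 0) {h : ι → G} {S : Finset ι}
    (zsf : ∀ T ⊆ S, T.Nonempty → ∑ i ∈ T, h i ≠ 0) {τ : G} {Ti Tj T : Finset ι}
    (hTi : Ti ⊆ S) (hTj : Tj ⊆ S) (hT : T ⊆ S)
    (si : ∑ i ∈ Ti, h i = τ) (sj : ∑ i ∈ Tj, h i = τ) (sT : ∑ i ∈ T, h i = τ) (hne : Ti ≠ Tj) :
    T ∩ (Ti ∪ Tj) ≠ Ti ∩ Tj := by
  intro htr
  apply hne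
  refine soloBlind_rep_sunflower_free three zsf hTi hTj hT si sj sT ?_ ?_
  · ext x
    constructor
    · intro hx
      have hx' : x ∈ T ∩ (Ti ∪ Tj) :=
        mem_inter.mpr ⟨(mem_inter.mp hx).2, mem_union_left _ (mem_inter.mp hx).1⟩
      rw [htr] at hx'
      exact hx'
    · intro hx
      have hx' : x ∈ T ∩ (Ti ∪ Tj) := htr ▸ hx
      exact mem_inter.mpr ⟨(mem_inter.mp hx).1, (mem_inter.mp hx').1⟩
  · ext x
    constructor
    · intro hx
      have hx' : x ∈ T ∩ (Ti ∪ Tj) :=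
        mem_inter.mpr ⟨(mem_inter.mp hx).2, mem_union_right _ (mem_inter.mp hx).1⟩
      rw [htr] at hx'
      exact hx'
    · intro hx
      have hx' : x ∈ T ∩ (Ti ∪ Tj) := htr ▸ hx
      exact mem_inter.mpr ⟨(mem_inter.mp hx).2, (mem_inter.mp hx').1⟩


/-- Two distinct representations of the same target by a zero-sum-free sequence are incomparable:
`Tᵢ \ Tⱼ` is non-empty. -/
theorem soloBlind_rep_sdiff_nonempty {h : ι → G} {S : Finset ι}
    (zsf : ∀ T ⊆ S, T.Nonempty → ∑ i ∈ T, h i ≠ 0) {τ : G} {Ti Tj : Finset ι}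
    (hTj : Tj ⊆ S) (si : ∑ i ∈ Ti, h i = τ) (sj : ∑ i ∈ Tj, h i = τ) (hne : Ti ≠ Tj) :
    (Ti \ Tj).Nonempty := by
  by_contra hempty
  rw [not_nonempty_iff_eq_empty, sdiff_eq_empty_iff_subset] at hempty
  have hz : ∑ i ∈ Tj \ Ti, h i = 0 := by rw [sum_sdiff_eq_sub hempty, sj, si, sub_self]
  by_cases hn : (Tj \ Ti).Nonempty
  · exact zsf _ (sdiff_subset.trans hTj) hn hz
  · rw [not_nonempty_iff_eq_empty, sdiff_eq_empty_iff_subset] at hn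
    exact hne (Subset.antisymm hempty hn)

omit [DecidableEq ι] in
/-- Under the H-goodness clause `Σ_T h ≠ σ + σ`, two representations of `σ` intersect. -/
theorem soloBlind_rep_not_disjoint {h : ι → G} {S : Finset ι} {σ : G}
    (hgood : ∀ T ⊆ S, ∑ i ∈ T, h i ≠ σ + σ) {Ti Tj : Finset ι} [DecidableEq ι]
    (hTi : Ti ⊆ S) (hTj : Tj ⊆ S) (si : ∑ i ∈ Ti, h i = σ) (sj : ∑ i ∈ Tj, h i = σ) :
    ¬ Disjoint Ti Tj := by
  intro hd
  exact hgood _ (union_subset hTi hTj) (by rw [sum_union hd, si, sj])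

/-- THEOREM PC(C≤1) (set language): a face with at most one C-killer has a rescued colouring — a red set
`R ⊆ Tᵢ ∪ Tⱼ` leaving no representation monochromatic (blue outside the face) and making the colouring good. -/
theorem soloBlind_face_rescued_of_CKiller_le_one [DecidableEq G] (three : ∀ g : G, g + g + g = 0) {h : ι → G}
    {S : Finset ι} (zsf : ∀ T ⊆ S, T.Nonempty → ∑ i ∈ T, h i ≠ 0) {σ : G}
    (hgood : ∀ T ⊆ S, ∑ i ∈ T, h i ≠ σ + σ) {Ti Tj : Finset ι}
    (hTi : Ti ⊆ S) (hTj : Tj ⊆ S) (si : ∑ i ∈ Ti, h i = σ) (sj : ∑ i ∈ Tj, h i = σ) (hne : Ti ≠ Tj)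
    (face : ∀ T ⊆ S, ∑ i ∈ T, h i = σ → T ⊆ Ti ∪ Tj → T = Ti ∨ T = Tj)
    (hC : ∀ T ⊆ S, ∀ T' ⊆ S, ∑ i ∈ T, h i = σ → ∑ i ∈ T', h i = σ → T ≠ Ti → T ≠ Tj → T' ≠ Ti →
      T' ≠ Tj → T ∩ (Ti ∪ Tj) ⊆ Ti ∩ Tj → T' ∩ (Ti ∪ Tj) ⊆ Ti ∩ Tj → T = T') :
    ∃ R ⊆ Ti ∪ Tj, R ∈ soloBlindGoodColourings h S σ ∧
      ∀ T ⊆ S, ∑ i ∈ T, h i = σ → (T ∩ R).Nonempty ∧ (T \ R).Nonempty := by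
  classical
  have hCTi : Ti ∩ Tj ⊆ Ti := inter_subset_left
  have hCTj : Ti ∩ Tj ⊆ Tj := inter_subset_right
  have hUS : Ti ∪ Tj ⊆ S := union_subset hTi hTj
  have hCne : (Ti ∩ Tj).Nonempty := by
    by_contra h'
    rw [not_nonempty_iff_eq_empty, ← disjoint_iff_inter_eq_empty] at h'
    exact soloBlind_rep_not_disjoint hgood hTi hTj si sj h'
  have hAne : (Ti \ Tj).Nonempty := soloBlind_rep_sdiff_nonempty zsf hTj si sj hne
  have hBne : (Tj \ Ti).Nonempty := soloBlind_rep_sdiff_nonempty zsf hTi sj si hne.symm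
  have eA : ∑ i ∈ Ti \ (Ti ∩ Tj), h i = σ - ∑ i ∈ Ti ∩ Tj, h i := by rw [sum_sdiff_eq_sub hCTi, si]
  have eB : ∑ i ∈ Tj \ (Ti ∩ Tj), h i = σ - ∑ i ∈ Ti ∩ Tj, h i := by rw [sum_sdiff_eq_sub hCTj, sj]
  have dAB : Disjoint (Ti \ (Ti ∩ Tj)) (Tj \ (Ti ∩ Tj)) := by
    rw [disjoint_left]
    intro x hxA hxB
    exact (mem_sdiff.mp hxA).2 (mem_inter.mpr ⟨(mem_sdiff.mp hxA).1, (mem_sdiff.mp hxB).1⟩)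
  -- every other representation sticks out of the face
  have out : ∀ T ⊆ S, ∑ i ∈ T, h i = σ → T ≠ Ti → T ≠ Tj → (T \ (Ti ∪ Tj)).Nonempty := by
    intro T hT sT h1 h2
    by_contra hempty
    rw [not_nonempty_iff_eq_empty, sdiff_eq_empty_iff_subset] at hempty
    rcases face T hT sT hempty with h' | h'
    · exact h1 h'
    · exact h2 h'
  -- an element of `T ∩ (Tᵢ ∪ Tⱼ)` outside the core lies in `(Tᵢ \ C) ∪ (Tⱼ \ C)`
  have split : ∀ x ∈ Ti ∪ Tj, x ∉ Ti ∩ Tj → x ∈ (Ti \ (Ti ∩ Tj)) ∪ (Tj \ (Ti ∩ Tj)) := by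
    intro x hx hxC
    rcases mem_union.mp hx with hx | hx
    · exact mem_union_left _ (mem_sdiff.mpr ⟨hx, hxC⟩)
    · exact mem_union_right _ (mem_sdiff.mpr ⟨hx, hxC⟩)
  by_cases hex : ∃ T ⊆ S, ∑ i ∈ T, h i = σ ∧ T ≠ Ti ∧ T ≠ Tj ∧ T ∩ (Ti ∪ Tj) ⊆ Ti ∩ Tj
  · -- ONE C-KILLER `Tc` with trace `τ = Tc ∩ (Tᵢ ∪ Tⱼ) ⊊ C`
    obtain ⟨Tc, hTc, sc, hc1, hc2, hτC⟩ := hex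
    have hτTc : Tc ∩ (Ti ∪ Tj) ⊆ Tc := inter_subset_left
    have hτne : Tc ∩ (Ti ∪ Tj) ≠ Ti ∩ Tj :=
      soloBlind_rep_trace_ne_core three zsf hTi hTj hTc si sj sc hne
    have hCτne : ((Ti ∩ Tj) \ (Tc ∩ (Ti ∪ Tj))).Nonempty := by
      by_contra h'
      rw [not_nonempty_iff_eq_empty, sdiff_eq_empty_iff_subset] at h'
      exact hτne (Subset.antisymm hτC h')
    have hτne' : (Tc ∩ (Ti ∪ Tj)).Nonempty := by
      by_contra h'
      rw [not_nonempty_iff_eq_empty, ← disjoint_iff_inter_eq_empty] at h'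
      exact soloBlind_rep_not_disjoint hgood hTc hTi sc si (h'.mono_right subset_union_left)
    have eτ : ∑ i ∈ Tc \ (Tc ∩ (Ti ∪ Tj)), h i = σ - ∑ i ∈ Tc ∩ (Ti ∪ Tj), h i := by
      rw [sum_sdiff_eq_sub hτTc, sc]
    have eCτ : ∑ i ∈ (Ti ∩ Tj) \ (Tc ∩ (Ti ∪ Tj)), h i
        = ∑ i ∈ Ti ∩ Tj, h i - ∑ i ∈ Tc ∩ (Ti ∪ Tj), h i := sum_sdiff_eq_sub hτC
    -- the red set `R = (Tᵢ \ C) ∪ (Tⱼ \ C) ∪ τ` and the blue certificate part `B' = (C \ τ) ∪ (Tc \ τ)`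
    have dRτ : Disjoint ((Ti \ (Ti ∩ Tj)) ∪ (Tj \ (Ti ∩ Tj))) (Tc ∩ (Ti ∪ Tj)) := by
      rw [disjoint_left]
      intro x hx hxτ
      have hxC : x ∈ Ti ∩ Tj := hτC hxτ
      rcases mem_union.mp hx with hx | hx <;> exact (mem_sdiff.mp hx).2 hxC
    have dB' : Disjoint ((Ti ∩ Tj) \ (Tc ∩ (Ti ∪ Tj))) (Tc \ (Tc ∩ (Ti ∪ Tj))) := by
      rw [disjoint_left]
      intro x hx hx'
      have hxU : x ∈ Ti ∪ Tj := mem_union_left _ (hCTi (mem_sdiff.mp hx).1)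
      exact (mem_sdiff.mp hx').2 (mem_inter.mpr ⟨(mem_sdiff.mp hx').1, hxU⟩)
    have hRU : (Ti \ (Ti ∩ Tj)) ∪ (Tj \ (Ti ∩ Tj)) ∪ (Tc ∩ (Ti ∪ Tj)) ⊆ Ti ∪ Tj :=
      union_subset (union_subset (sdiff_subset.trans subset_union_left)
        (sdiff_subset.trans subset_union_right)) inter_subset_right
    have hRS : (Ti \ (Ti ∩ Tj)) ∪ (Tj \ (Ti ∩ Tj)) ∪ (Tc ∩ (Ti ∪ Tj)) ⊆ S := hRU.trans hUS
    have notR : ∀ x ∈ Ti ∩ Tj, x ∉ Tc ∩ (Ti ∪ Tj) →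
        x ∉ (Ti \ (Ti ∩ Tj)) ∪ (Tj \ (Ti ∩ Tj)) ∪ (Tc ∩ (Ti ∪ Tj)) := by
      intro x hxC hxτ hxR
      rcases mem_union.mp hxR with hxR | hxR
      · rcases mem_union.mp hxR with hxR | hxR <;> exact (mem_sdiff.mp hxR).2 hxC
      · exact hxτ hxR
    have hB'S : ((Ti ∩ Tj) \ (Tc ∩ (Ti ∪ Tj))) ∪ (Tc \ (Tc ∩ (Ti ∪ Tj)))
        ⊆ S \ ((Ti \ (Ti ∩ Tj)) ∪ (Tj \ (Ti ∩ Tj)) ∪ (Tc ∩ (Ti ∪ Tj))) := by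
      intro x hx
      rw [mem_sdiff]
      rcases mem_union.mp hx with hx | hx
      · exact ⟨hUS (mem_union_left _ (hCTi (mem_sdiff.mp hx).1)),
          notR x (mem_sdiff.mp hx).1 (mem_sdiff.mp hx).2⟩
      · refine ⟨hTc (mem_sdiff.mp hx).1, fun hxR => ?_⟩
        exact (mem_sdiff.mp hx).2 (mem_inter.mpr ⟨(mem_sdiff.mp hx).1, hRU hxR⟩)
    have hw : ∑ i ∈ (Ti \ (Ti ∩ Tj)) ∪ (Tj \ (Ti ∩ Tj)) ∪ (Tc ∩ (Ti ∪ Tj)), h i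
        - ∑ i ∈ ((Ti ∩ Tj) \ (Tc ∩ (Ti ∪ Tj))) ∪ (Tc \ (Tc ∩ (Ti ∪ Tj))), h i = σ := by
      rw [sum_union dRτ, sum_union dAB, sum_union dB', eA, eB, eτ, eCτ]
      have h3 := three (∑ i ∈ Ti ∩ Tj, h i)
      have h3' := three (∑ i ∈ Tc ∩ (Ti ∪ Tj), h i)
      calc σ - ∑ i ∈ Ti ∩ Tj, h i + (σ - ∑ i ∈ Ti ∩ Tj, h i) + ∑ i ∈ Tc ∩ (Ti ∪ Tj), h i
            - (∑ i ∈ Ti ∩ Tj, h i - ∑ i ∈ Tc ∩ (Ti ∪ Tj), h i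
              + (σ - ∑ i ∈ Tc ∩ (Ti ∪ Tj), h i))
          = σ - (∑ i ∈ Ti ∩ Tj, h i + ∑ i ∈ Ti ∩ Tj, h i + ∑ i ∈ Ti ∩ Tj, h i)
            + (∑ i ∈ Tc ∩ (Ti ∪ Tj), h i + ∑ i ∈ Tc ∩ (Ti ∪ Tj), h i
              + ∑ i ∈ Tc ∩ (Ti ∪ Tj), h i) := by abel
        _ = σ := by rw [h3, h3', sub_zero, add_zero]
    refine ⟨(Ti \ (Ti ∩ Tj)) ∪ (Tj \ (Ti ∩ Tj)) ∪ (Tc ∩ (Ti ∪ Tj)), hRU, ?_, ?_⟩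
    · rw [soloBlind_mem_goodColourings]
      refine ⟨hRS, Or.inr ⟨_, ?_, soloBlind_subsum_of_cert h disjoint_sdiff hB'S hw⟩⟩
      exact union_subset hRS (sdiff_subset.trans sdiff_subset)
    · intro T hT sT
      by_cases h1 : T = Ti
      · rw [h1]
        obtain ⟨x, hx⟩ := hAne
        obtain ⟨y, hy⟩ := hCτne
        refine ⟨⟨x, mem_inter.mpr ⟨(mem_sdiff.mp hx).1, mem_union_left _ (mem_union_left _
          (mem_sdiff.mpr ⟨(mem_sdiff.mp hx).1, fun hxC => (mem_sdiff.mp hx).2 (hCTj hxC)⟩))⟩⟩,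
          ⟨y, mem_sdiff.mpr ⟨hCTi (mem_sdiff.mp hy).1, notR y (mem_sdiff.mp hy).1 (mem_sdiff.mp hy).2⟩⟩⟩
      by_cases h2 : T = Tj
      · rw [h2]
        obtain ⟨x, hx⟩ := hBne
        obtain ⟨y, hy⟩ := hCτne
        refine ⟨⟨x, mem_inter.mpr ⟨(mem_sdiff.mp hx).1, mem_union_left _ (mem_union_right _
          (mem_sdiff.mpr ⟨(mem_sdiff.mp hx).1, fun hxC => (mem_sdiff.mp hx).2 (hCTi hxC)⟩))⟩⟩,
          ⟨y, mem_sdiff.mpr ⟨hCTj (mem_sdiff.mp hy).1, notR y (mem_sdiff.mp hy).1 (mem_sdiff.mp hy).2⟩⟩⟩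
      -- any other representation has a blue element outside the face …
      obtain ⟨w, hw'⟩ := out T hT sT h1 h2
      refine ⟨?_, ⟨w, mem_sdiff.mpr ⟨(mem_sdiff.mp hw').1, fun hwR => (mem_sdiff.mp hw').2 (hRU hwR)⟩⟩⟩
      by_cases h3 : T = Tc
      · rw [h3]
        obtain ⟨z, hz⟩ := hτne'
        exact ⟨z, mem_inter.mpr ⟨hτTc hz, mem_union_right _ hz⟩⟩
      -- … and a red one, or else it would be a second C-killer
      by_contra hred
      rw [not_nonempty_iff_eq_empty] at hred
      have htr : T ∩ (Ti ∪ Tj) ⊆ Ti ∩ Tj := by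
        intro x hx
        by_contra hxC
        have hxR := split x (mem_inter.mp hx).2 hxC
        have : x ∈ T ∩ ((Ti \ (Ti ∩ Tj)) ∪ (Tj \ (Ti ∩ Tj)) ∪ (Tc ∩ (Ti ∪ Tj))) :=
          mem_inter.mpr ⟨(mem_inter.mp hx).1, mem_union_left _ hxR⟩
        rw [hred] at this
        simp at this
      exact h3 (hC T hT Tc hTc sT sc h1 h2 hc1 hc2 htr hτC)
  · -- NO C-KILLER: `R = (Tᵢ \ C) ∪ (Tⱼ \ C)`, value `V = C`
    push Not at hex
    have hRU : (Ti \ (Ti ∩ Tj)) ∪ (Tj \ (Ti ∩ Tj)) ⊆ Ti ∪ Tj :=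
      union_subset (sdiff_subset.trans subset_union_left) (sdiff_subset.trans subset_union_right)
    have hRS : (Ti \ (Ti ∩ Tj)) ∪ (Tj \ (Ti ∩ Tj)) ⊆ S := hRU.trans hUS
    have notR : ∀ x ∈ Ti ∩ Tj, x ∉ (Ti \ (Ti ∩ Tj)) ∪ (Tj \ (Ti ∩ Tj)) := by
      intro x hxC hxR
      rcases mem_union.mp hxR with hxR | hxR <;> exact (mem_sdiff.mp hxR).2 hxC
    refine ⟨(Ti \ (Ti ∩ Tj)) ∪ (Tj \ (Ti ∩ Tj)), hRU, ?_, ?_⟩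
    · rw [soloBlind_mem_goodColourings]
      refine ⟨hRS, Or.inl ⟨Ti ∩ Tj, hCTi.trans hTi, ?_⟩⟩
      rw [sum_union dAB, eA, eB]
      have h3 := three σ
      have h3' := three (∑ i ∈ Ti ∩ Tj, h i)
      calc ∑ i ∈ Ti ∩ Tj, h i
          = ∑ i ∈ Ti ∩ Tj, h i + (σ + σ + σ)
            - (∑ i ∈ Ti ∩ Tj, h i + ∑ i ∈ Ti ∩ Tj, h i + ∑ i ∈ Ti ∩ Tj, h i) := by
              rw [h3, h3', add_zero, sub_zero]
        _ = σ + (σ - ∑ i ∈ Ti ∩ Tj, h i + (σ - ∑ i ∈ Ti ∩ Tj, h i)) := by abel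
    · intro T hT sT
      by_cases h1 : T = Ti
      · rw [h1]
        obtain ⟨x, hx⟩ := hAne
        obtain ⟨y, hy⟩ := hCne
        exact ⟨⟨x, mem_inter.mpr ⟨(mem_sdiff.mp hx).1, mem_union_left _
          (mem_sdiff.mpr ⟨(mem_sdiff.mp hx).1, fun hxC => (mem_sdiff.mp hx).2 (hCTj hxC)⟩)⟩⟩,
          ⟨y, mem_sdiff.mpr ⟨hCTi hy, notR y hy⟩⟩⟩
      by_cases h2 : T = Tj
      · rw [h2]
        obtain ⟨x, hx⟩ := hBne
        obtain ⟨y, hy⟩ := hCne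
        exact ⟨⟨x, mem_inter.mpr ⟨(mem_sdiff.mp hx).1, mem_union_right _
          (mem_sdiff.mpr ⟨(mem_sdiff.mp hx).1, fun hxC => (mem_sdiff.mp hx).2 (hCTi hxC)⟩)⟩⟩,
          ⟨y, mem_sdiff.mpr ⟨hCTj hy, notR y hy⟩⟩⟩
      obtain ⟨w, hw'⟩ := out T hT sT h1 h2
      refine ⟨?_, ⟨w, mem_sdiff.mpr ⟨(mem_sdiff.mp hw').1, fun hwR => (mem_sdiff.mp hw').2 (hRU hwR)⟩⟩⟩
      by_contra hred
      rw [not_nonempty_iff_eq_empty] at hred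
      have htr : T ∩ (Ti ∪ Tj) ⊆ Ti ∩ Tj := by
        intro x hx
        by_contra hxC
        have hxR := split x (mem_inter.mp hx).2 hxC
        have : x ∈ T ∩ ((Ti \ (Ti ∩ Tj)) ∪ (Tj \ (Ti ∩ Tj))) :=
          mem_inter.mpr ⟨(mem_inter.mp hx).1, hxR⟩
        rw [hred] at this
        simp at this
      exact hex T hT sT h1 h2 htr

end Summit.MatrixMultiplication.MatrixMultiplication.Theorems
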